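import Literature.AlgebraicGeometry.HodgeTheory.WeilClassTestChargeZeroLemma
import Literature.AlgebraicGeometry.HodgeTheory.WeilClassTestChargeZeroLemmaThreeAtoms
import Literature.AlgebraicGeometry.HodgeTheory.WeilClassTestChargeZeroLemmaMatrix
import Literature.AlgebraicGeometry.HodgeTheory.WeilClassTestChargeZeroLemmaGeneral
import HarnessLib

/-!
# The charge-zero lemma: assembly — THEOREM 1 unconditional for any finite family of atoms

Discharges the three hypotheses of `key_inequality` / `theorem1_psd` (`WeilClassTestChargeZeroLemmaGeneral.lean`) with the
companion theorems: `at_most_one_exceptional_le` (Matrix file), the two-atom certificate (from `cert2_nonneg`, main file, via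
the bridge `twoAtoms_calP_nonneg` below) and `threeAtoms_calP_nonneg` (ThreeAtoms file). Result: for every finite family of
weighted points with `|x_k| ≤ p_k`, `T = Σp`, `M = Σx_kp_k`, `V_k = T² + M − 3Tx_k`, `a_k = p_k(2T − x_k)`, the matrix
`diag(a_kV_k) + aaᵀ` is positive semidefinite, and `1 + Σ a_k/V_k ≤ 0` whenever some `V_i < 0` — Theorem 1 of the note
`b2b-hweil-pv2-g8/CHARGE-ZERO-LEMMA.md` (prover 2, generation 8, hodge-weil ladder cell), kernel-checked in full. What remains
dictionary for Lemma N₂′ itself is only Steps 1–3 of §4 (the multiplier rewriting of `Q₂` and the bordered determinant).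
-/

namespace Literature.AlgebraicGeometry.HodgeTheory.WeilClassTestChargeZeroLemma

/-- Two-atom certificate in `(p, x)` form: `0 ≤ p₁U₁V₂ + p₂U₂V₁` for `|x_k| ≤ p_k` (`T = p₁+p₂`, `M = x₁p₁+x₂p₂`), from
`cert2_nonneg` with `α = p + x`, `β = p − x` (the product form there is `32×` this one). [folklore] -/
theorem twoAtoms_calP_nonneg (p₁ p₂ x₁ x₂ : ℝ) (h₁ : |x₁| ≤ p₁) (h₂ : |x₂| ≤ p₂) :
    0 ≤ p₁ * (3 * (p₁ + p₂) ^ 2 + (x₁ * p₁ + x₂ * p₂) - 4 * (p₁ + p₂) * x₁)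
            * ((p₁ + p₂) ^ 2 + (x₁ * p₁ + x₂ * p₂) - 3 * (p₁ + p₂) * x₂)
        + p₂ * (3 * (p₁ + p₂) ^ 2 + (x₁ * p₁ + x₂ * p₂) - 4 * (p₁ + p₂) * x₂)
            * ((p₁ + p₂) ^ 2 + (x₁ * p₁ + x₂ * p₂) - 3 * (p₁ + p₂) * x₁) := by
  have hc := cert2_nonneg (p₁ + x₁) (p₂ + x₂) (p₁ - x₁) (p₂ - x₂)
    (by linarith [neg_abs_le x₁]) (by linarith [neg_abs_le x₂])
    (by linarith [le_abs_self x₁]) (by linarith [le_abs_self x₂])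
  have he : ((p₁ + x₁) + (p₁ - x₁)) * (3 * (((p₁ + x₁) + (p₁ - x₁)) + ((p₂ + x₂) + (p₂ - x₂))) ^ (2 : ℕ)
        + (((p₁ + x₁) - (p₁ - x₁)) * ((p₁ + x₁) + (p₁ - x₁)) + ((p₂ + x₂) - (p₂ - x₂)) * ((p₂ + x₂) + (p₂ - x₂)))
        - 4 * (((p₁ + x₁) + (p₁ - x₁)) + ((p₂ + x₂) + (p₂ - x₂))) * ((p₁ + x₁) - (p₁ - x₁)))
        * ((((p₁ + x₁) + (p₁ - x₁)) + ((p₂ + x₂) + (p₂ - x₂))) ^ (2 : ℕ)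
        + (((p₁ + x₁) - (p₁ - x₁)) * ((p₁ + x₁) + (p₁ - x₁)) + ((p₂ + x₂) - (p₂ - x₂)) * ((p₂ + x₂) + (p₂ - x₂)))
        - 3 * (((p₁ + x₁) + (p₁ - x₁)) + ((p₂ + x₂) + (p₂ - x₂))) * ((p₂ + x₂) - (p₂ - x₂)))
      + ((p₂ + x₂) + (p₂ - x₂)) * (3 * (((p₁ + x₁) + (p₁ - x₁)) + ((p₂ + x₂) + (p₂ - x₂))) ^ (2 : ℕ)
        + (((p₁ + x₁) - (p₁ - x₁)) * ((p₁ + x₁) + (p₁ - x₁)) + ((p₂ + x₂) - (p₂ - x₂)) * ((p₂ + x₂) + (p₂ - x₂)))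
        - 4 * (((p₁ + x₁) + (p₁ - x₁)) + ((p₂ + x₂) + (p₂ - x₂))) * ((p₂ + x₂) - (p₂ - x₂)))
        * ((((p₁ + x₁) + (p₁ - x₁)) + ((p₂ + x₂) + (p₂ - x₂))) ^ (2 : ℕ)
        + (((p₁ + x₁) - (p₁ - x₁)) * ((p₁ + x₁) + (p₁ - x₁)) + ((p₂ + x₂) - (p₂ - x₂)) * ((p₂ + x₂) + (p₂ - x₂)))
        - 3 * (((p₁ + x₁) + (p₁ - x₁)) + ((p₂ + x₂) + (p₂ - x₂))) * ((p₁ + x₁) - (p₁ - x₁)))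
      = 32 * (p₁ * (3 * (p₁ + p₂) ^ 2 + (x₁ * p₁ + x₂ * p₂) - 4 * (p₁ + p₂) * x₁)
            * ((p₁ + p₂) ^ 2 + (x₁ * p₁ + x₂ * p₂) - 3 * (p₁ + p₂) * x₂)
        + p₂ * (3 * (p₁ + p₂) ^ 2 + (x₁ * p₁ + x₂ * p₂) - 4 * (p₁ + p₂) * x₂)
            * ((p₁ + p₂) ^ 2 + (x₁ * p₁ + x₂ * p₂) - 3 * (p₁ + p₂) * x₁)) := by
    ring
  refine le_of_mul_le_mul_left ?_ (by norm_num : (0 : ℝ) < 32)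
  rw [mul_zero, ← he]
  exact hc

/-- THEOREM 1 (key-inequality form), unconditional, any finite family of atoms. [cite: HardyLittlewoodPolya1952, §3.5] -/
theorem key_inequality_unconditional {ι : Type*} [Fintype ι] [DecidableEq ι]
    (p x : ι → ℝ) (hp : ∀ k, 0 < p k) (hx : ∀ k, |x k| ≤ p k)
    (T M : ℝ) (hT : T = ∑ k, p k) (hM : M = ∑ k, x k * p k)
    (V a : ι → ℝ) (hV : ∀ k, V k = T ^ 2 + M - 3 * T * x k) (ha : ∀ k, a k = p k * (2 * T - x k))
    (i : ι) (hVi : V i < 0) :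
    1 + ∑ k, a k / V k ≤ 0 :=
  key_inequality at_most_one_exceptional_le twoAtoms_calP_nonneg threeAtoms_calP_nonneg p x hp hx T M hT hM V a hV ha i hVi

/-- THEOREM 1 (matrix form), unconditional, any finite family of atoms: `diag(a_kV_k) + aaᵀ ⪰ 0`.
[cite: HornJohnson2013, §7.7] -/
theorem theorem1_psd_unconditional {ι : Type*} [Fintype ι] [DecidableEq ι]
    (p x : ι → ℝ) (hp : ∀ k, 0 < p k) (hx : ∀ k, |x k| ≤ p k)
    (T M : ℝ) (hT : T = ∑ k, p k) (hM : M = ∑ k, x k * p k)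
    (V a : ι → ℝ) (hV : ∀ k, V k = T ^ 2 + M - 3 * T * x k) (ha : ∀ k, a k = p k * (2 * T - x k))
    (z : ι → ℝ) :
    0 ≤ ∑ k, a k * V k * z k ^ 2 + (∑ k, a k * z k) ^ 2 :=
  theorem1_psd at_most_one_exceptional_le twoAtoms_calP_nonneg threeAtoms_calP_nonneg p x hp hx T M hT hM V a hV ha z

end Literature.AlgebraicGeometry.HodgeTheory.WeilClassTestChargeZeroLemma
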